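import Mathlib
import HarnessLib
import Summits.HubbardSuperconductivity.HubbardSuperconductivity.Theorems.KLProgrammeKLRegimeEngineTowerBlockIncrWtPowAtKitCarrier
import Summits.HubbardSuperconductivity.HubbardSuperconductivity.Theorems.KLProgrammeKLRegimeEngineTowerBlockIncrWtKitUnits

/-!
# Route `KLProgramme` — crux K3 ENGINE (stmt-HubbardSuperconductivity-20437 `KLRegimeEngineV17F2`), stub (b) / E1 interface (E2) in-tower route and located risk #17
# «(C2)-MOMENTS» / located «(E2)-ROUTE-TADPOLE»: THE SHARP KIT FORM OF THE TADPOLE-FREE DEGREE-`Dw` Hstep — first order = `towerFO` on the measured array with the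
# input degrees `≤ q+2` ZEROED (no `C(2q+4,2q+2)·κ²·N(q+2)` term: for two legs, no quartic-tadpole size), carrier and units forms
# (recipe «(E2)-POW3-TRACK» items T5/T6, HOME/hubbard-kl-k3c3-p2/g19/E2-POW3-TRACK-RECIPE.md §3/§7; pen g27 (R472)(D), (R479); cell gate-hubbard-kl, seat hubbard-kl-k3c3-p2 g20)

The door `klWtPinnedSumPow_klTowerIncr_subTadpole_le` (✓ …TowerBlockIncrWtPowAtSubTadpole) bounds the degree-`Dw` pinned sums of `Δ_k − Δ_Γ 𝒱_{dk}` by the graded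
bracket (orders `≥ 2`) plus the «minus-one-line» binomial sum over input degrees `m′ > q+2`.  Its kit form of record `…_subTadpole_le_kit` (✓ …TowerBlockIncrWtPowAtKit)
majorises that binomial sum by the FULL `towerFO D κ² N (q+1)` (sum over `m′ > q+1`) and so re-admits, in the numerics, the tadpole-sized term `C(2q+4,2q+2)·κ²·N(q+2)`
(for `q = 0`: `6κ²·N 2`, first order in the four-leg input) that the door had removed.  This file keeps the door's sharpness through the kit dictionary: the binomial
sum over `m′ > q+2` IS dominated by `towerFO D κ² N♭ (q+1)` with the TRUNCATED array `N♭ m := if q+2 < m then N m else 0` (`doorBinomial_le_towerFO` at `N♭`), while the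
graded bracket and the tail keep the full array `N` (`doorGraded_le_kitStep`):

* §1 `towerNumerics_doorBracketsSub_le_kit` — pure real algebra: the two door brackets of the tadpole-free door `≤ cr·cc^{2q+1}·(towerFO D κ² N♭ (q+1) + Σ graded(N) + tail(N))`;
  `kitStep_units_trunc`, `kitStep_abs_eq_units_mul_trunc` — the units identities of …TowerKitUnits / …TowerBlockIncrWtKitUnits with the first order on a second array;
* §2 **`klWtPinnedSumPow_klTowerIncr_subTadpole_le_kit_sharp (jr Dw)`** — the degree-`Dw` model Hstep in SHARP kit form for `Δ_k − Δ_Γ 𝒱_{dk}` (binders of `…_le_kit`);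
* §3 **`klTowerBornWtPowSubTadAt_le_kit_sharp (j Dw)`** — the same ON THE CARRIER `klTowerBornWtPowSubTadAt` (✓ …TowerModelDefsWtPowAt), input sizes served by
  `klTowerMeasWtPowAt`; `towerInputSizesPow_trunc_eq`;
* §4 **`klTowerBornWtPowSubTadAt_le_kit_units (j Dw)`** — the carrier form divided by any unit pair `(u, Kc)` (twin of `klTowerBornWtPowAt_le_kit_units`), the truncated
  dimensionless array `μ♭ m := if q+2 < m then klTowerMeasWtPowAt … (2m)/(Kc·u^m) else 0` in the first order.
Compositions of landed theorems and real algebra; block constants (`κ`, degree-`Dw` weighted `α`, `cr/cc`) are HYPOTHESES; nothing asserts (E2), (X).3, any stub, K3 or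
superconductivity.  References: BGM 2006 §2.7 (2.70)–(2.71a), §2.8 (2.77), (2.81)–(2.84), (2.86)–(2.90), §3 (3.2)–(3.8) [cite: BenfattoGiulianiMastropietro2006].
-/

noncomputable section

namespace Summit.HubbardSuperconductivity.HubbardSuperconductivity.Theorems.EngineV8

set_option linter.dupNamespace false -- summit = problem name (single-conjunct summit), D-0017

open Real Finset Literature.MathematicalPhysics.QuantumLattice Literature.Probability.LatticeModels GrassmannAlgebra
open Literature.MathematicalPhysics.QuantumLattice.BandSectorCounting
open Summit.HubbardSuperconductivity.HubbardSuperconductivity.Theorems.KLProgrammeLegKernels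
open Summit.HubbardSuperconductivity.HubbardSuperconductivity.Theorems.KLRegimeSplit
open Summit.HubbardSuperconductivity.HubbardSuperconductivity.Theorems.KLRegimeWick
open Summit.HubbardSuperconductivity.HubbardSuperconductivity.Theorems.TwoPointAssembly
open Summit.HubbardSuperconductivity.HubbardSuperconductivity.Theorems.TorusFourierL2
open Summit.HubbardSuperconductivity.HubbardSuperconductivity.Theorems.DispersionFlow
open Literature.Probability.LatticeModels.BattleFederbush

/-! ## §1 Pure real algebra: the tadpole-free door brackets against the kit with a truncated first-order array; units with two arrays -/

/-- **The «minus-one-line» binomial sum IS dominated by `towerFO` on the truncated array** (`σ := κ²`): for `κ ≥ 0`, `N ≥ 0`, `D_Γ ≤ D`,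
`Σ_{m′ < D_Γ+1} (if q+2 < m′ then C(2m′,2(q+1))·κ^{2m′−2(q+1)}·N m′ else 0) ≤ towerFO D (κ²) (fun m ↦ if q+2 < m then N m else 0) (q+1)` — no `m′ = q+2` term on either side. -/
theorem doorBinomialSub_le_towerFO_trunc {κ : ℝ} (hκ : 0 ≤ κ) {N : ℕ → ℝ} (hN0 : ∀ m, 0 ≤ N m) {DΓ D : ℕ} (hD : DΓ ≤ D) (q : ℕ) :
    ∑ m' ∈ range (DΓ + 1), (if q + 1 + 1 < m' then ((2 * m').choose (2 * (q + 1)) : ℝ) * κ ^ (2 * m' - 2 * (q + 1)) * N m' else 0) ≤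
      towerFO D (κ ^ 2) (fun m => if q + 2 < m then N m else 0) (q + 1) := by
  have hN0' : ∀ m, 0 ≤ (fun m => if q + 2 < m then N m else 0) m := fun m => by
    dsimp only; split_ifs; exacts [hN0 m, le_rfl]
  refine le_trans (le_of_eq (sum_congr rfl fun m' _ => ?_)) (doorBinomial_le_towerFO hκ hN0' hD q)
  by_cases h : q + 2 < m'
  · rw [if_pos (by omega), if_pos (by omega), if_pos h]
  · rw [if_neg (by omega)]
    by_cases h' : q + 1 < m'
    · rw [if_pos h', if_neg h, mul_zero]
    · rw [if_neg h']

/-- **Tadpole-free door brackets `≤` kit terms with the truncated first-order array.**  For `κ, ρ > 0`, `α, cr, cc ≥ 0`, sizes `N ≥ 0` with `N 0 = 0`, `D ≥ |Γ|/2`,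
`N₀ ≥ 2` and the KIT guard `(eα/κ²)·towerV D (e²(κ+ρ))² N < 1`:
`cr·cc^{2q+1}·[graded bracket(N)] + cr·cc^{2q+1}·[binomial sum over m′ > q+2] ≤ cr·cc^{2q+1}·(towerFO D κ² N♭ (q+1) + Σ_{n∈Icc 2 (N₀−1)} e·Φ^{n−1}·ψ^{q+1}·towerS D τ N n (q+1) + tail(N))`,
`N♭ m := if q+2 < m then N m else 0`, `τ = (e²(κ+ρ))²`, `Φ = eα/κ²`, `ψ = ρ⁻²`. -/
theorem towerNumerics_doorBracketsSub_le_kit {Γ : Type*} [Fintype Γ] {κ ρ α cr cc : ℝ} (hκ : 0 < κ) (hρ : 0 < ρ) (hα : 0 ≤ α)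
    (hcr : 0 ≤ cr) (hcc : 0 ≤ cc) {N : ℕ → ℝ} (hN0 : ∀ m, 0 ≤ N m) (hN00 : N 0 = 0) {D : ℕ} (hD : Fintype.card Γ / 2 ≤ D)
    {N₀ : ℕ} (hN₀ : 2 ≤ N₀) (q : ℕ)
    (hguard : exp 1 * α / κ ^ 2 * towerV D ((exp 2 * (κ + ρ)) ^ 2) N < 1) :
    cr * cc ^ (2 * q + 1) *
        ((∑ n ∈ Ico 2 N₀, (ρ⁻¹ ^ (2 * q + 1 + 1) * κ⁻¹ ^ (2 * (n - 1)) * (α ^ (n - 1) * exp n)) *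
            ∑ δ ∈ (Fintype.piFinset fun _ : Fin n => range (Fintype.card Γ / 2 + 1)) with 2 * q + 1 + 1 + 2 * (n - 1) ≤ ∑ a, 2 * δ a,
              ∏ a, (exp 2 * (κ + ρ)) ^ (2 * δ a) * N (δ a)) +
          ρ⁻¹ ^ (2 * q + 1 + 1) * (exp 1 * normV Γ κ ρ N) * (exp 1 * α * normV Γ κ ρ N / κ ^ 2) ^ (N₀ - 1) /
            (1 - exp 1 * α * normV Γ κ ρ N / κ ^ 2)) +
      cr * cc ^ (2 * q + 1) *
        ∑ m' ∈ range (Fintype.card Γ / 2 + 1),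
          (if q + 1 + 1 < m' then ((2 * m').choose (2 * (q + 1)) : ℝ) * κ ^ (2 * m' - 2 * (q + 1)) * N m' else 0) ≤
    cr * cc ^ (2 * q + 1) *
      (towerFO D (κ ^ 2) (fun m => if q + 2 < m then N m else 0) (q + 1) +
        ∑ n ∈ Icc 2 (N₀ - 1), exp 1 * (exp 1 * α / κ ^ 2) ^ (n - 1) * (ρ⁻¹ ^ 2) ^ (q + 1) *
          towerS D ((exp 2 * (κ + ρ)) ^ 2) N n (q + 1) +
        (ρ⁻¹ ^ 2) ^ (q + 1) * exp 1 * towerV D ((exp 2 * (κ + ρ)) ^ 2) N *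
          (exp 1 * α / κ ^ 2 * towerV D ((exp 2 * (κ + ρ)) ^ 2) N) ^ (N₀ - 1) /
          (1 - exp 1 * α / κ ^ 2 * towerV D ((exp 2 * (κ + ρ)) ^ 2) N)) := by
  have hgr := doorGraded_le_kitStep (Γ := Γ) hκ hρ hα hN0 hN00 hD hN₀ (m := 2 * q + 1) (p := q + 1) (by ring) hguard
  have hfo := doorBinomialSub_le_towerFO_trunc hκ.le hN0 hD q
  have htail : (ρ⁻¹ ^ 2) ^ (q + 1) * (exp 1 * towerV D ((exp 2 * (κ + ρ)) ^ 2) N *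
        (exp 1 * α / κ ^ 2 * towerV D ((exp 2 * (κ + ρ)) ^ 2) N) ^ (N₀ - 1) /
        (1 - exp 1 * α / κ ^ 2 * towerV D ((exp 2 * (κ + ρ)) ^ 2) N)) =
      (ρ⁻¹ ^ 2) ^ (q + 1) * exp 1 * towerV D ((exp 2 * (κ + ρ)) ^ 2) N *
          (exp 1 * α / κ ^ 2 * towerV D ((exp 2 * (κ + ρ)) ^ 2) N) ^ (N₀ - 1) /
          (1 - exp 1 * α / κ ^ 2 * towerV D ((exp 2 * (κ + ρ)) ^ 2) N) := by
    ring
  rw [← mul_add]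
  refine mul_le_mul_of_nonneg_left ?_ (by positivity)
  rw [htail] at hgr
  linarith

/-- **Units with the first order on a second array**: `(towerFO(b♭) + graded(b) + tail(b))/(u^p·K)` in the kit's dimensionless parameters `(σu, τu, ΦK, ψ/u)`
(`kitFO_units` on `b♭`, `kitGraded_units` / `kitTail_units` on `b`). -/
theorem kitStep_units_trunc {K u : ℝ} (hK : K ≠ 0) (hu : u ≠ 0) (D : ℕ) (σ τ Φ ψ : ℝ) (b b' : ℕ → ℝ) (N p : ℕ) :
    (towerFO D σ (fun m => K * (u ^ m * b' m)) p +
        ∑ n ∈ Icc 2 N, exp 1 * Φ ^ (n - 1) * ψ ^ p * towerS D τ (fun m => K * (u ^ m * b m)) n p +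
        ψ ^ p * exp 1 * towerV D τ (fun m => K * (u ^ m * b m)) * (Φ * towerV D τ (fun m => K * (u ^ m * b m))) ^ N /
          (1 - Φ * towerV D τ (fun m => K * (u ^ m * b m)))) / (u ^ p * K) =
      towerFO D (σ * u) b' p + ∑ n ∈ Icc 2 N, exp 1 * (Φ * K) ^ (n - 1) * (ψ / u) ^ p * towerS D (τ * u) b n p +
        (ψ / u) ^ p * exp 1 * towerV D (τ * u) b * (Φ * K * towerV D (τ * u) b) ^ N / (1 - Φ * K * towerV D (τ * u) b) := by
  rw [add_div, add_div, kitFO_units hK hu, kitGraded_units hK hu, kitTail_units hK hu]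

/-- The multiplied-out form of `kitStep_units_trunc` (twin of `kitStep_abs_eq_units_mul`). -/
theorem kitStep_abs_eq_units_mul_trunc {K u : ℝ} (hK : K ≠ 0) (hu : u ≠ 0) (D : ℕ) (σ τ Φ ψ : ℝ) (b b' : ℕ → ℝ) (N p : ℕ) :
    towerFO D σ (fun m => K * (u ^ m * b' m)) p +
        ∑ n ∈ Icc 2 N, exp 1 * Φ ^ (n - 1) * ψ ^ p * towerS D τ (fun m => K * (u ^ m * b m)) n p +
        ψ ^ p * exp 1 * towerV D τ (fun m => K * (u ^ m * b m)) * (Φ * towerV D τ (fun m => K * (u ^ m * b m))) ^ N /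
          (1 - Φ * towerV D τ (fun m => K * (u ^ m * b m))) =
      (u ^ p * K) *
        (towerFO D (σ * u) b' p + ∑ n ∈ Icc 2 N, exp 1 * (Φ * K) ^ (n - 1) * (ψ / u) ^ p * towerS D (τ * u) b n p +
          (ψ / u) ^ p * exp 1 * towerV D (τ * u) b * (Φ * K * towerV D (τ * u) b) ^ N / (1 - Φ * K * towerV D (τ * u) b)) := by
  have h := kitStep_units_trunc hK hu D σ τ Φ ψ b b' N p
  have hne : u ^ p * K ≠ 0 := mul_ne_zero (pow_ne_zero _ hu) hK
  rw [div_eq_iff hne] at h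
  rw [h]; ring

/-- **Units on a truncated array**: for `u, Kc ≠ 0`, `(if q+2 < m then ε·Meas(2m) else 0) = (ε·Kc)·(u^m·(if q+2 < m then Meas(2m)/(Kc·u^m) else 0))`. -/
theorem towerInputSizes_units_trunc {ε u Kc : ℝ} (hu : u ≠ 0) (hKc : Kc ≠ 0) (Meas : ℕ → ℝ) (q : ℕ) :
    (fun m : ℕ => if q + 2 < m then ε * Meas (2 * m) else 0) =
      fun m : ℕ => (ε * Kc) * (u ^ m * (if q + 2 < m then Meas (2 * m) / (Kc * u ^ m) else 0)) := by
  funext m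
  have : u ^ m ≠ 0 := pow_ne_zero _ hu
  split_ifs
  · field_simp
  · simp

/-! ## §2 The degree-`Dw` model Hstep in SHARP kit form, increment without its block tadpole — binder version -/

variable {L M : ℕ} [NeZero L]

section Born

variable [NeZero M]

/-- **THE DEGREE-`Dw` MODEL Hstep IN SHARP KIT FORM, increment WITHOUT its block tadpole** `Δ_k − Δ_Γ 𝒱_{dk}` (`klWtPinnedSumPow` currency): binders of
`klWtPinnedSumPow_klTowerIncr_subTadpole_le_kit`; the first order is `towerFO D κ² N♭ (q+1)` on the TRUNCATED sizes `N♭ m′ := if q+2 < m′ then ε^{2m′}·B m′ else 0`.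
[cite: BenfattoGiulianiMastropietro2006, (2.70)-(2.71a), (2.77), (2.81)-(2.84), (2.86)-(2.90), (3.2)-(3.8)] -/
theorem klWtPinnedSumPow_klTowerIncr_subTadpole_le_kit_sharp {β : ℝ} (hβ : 0 < β) (U μ : ℝ) (K : TrigPolyC4v) (jr Dw : ℕ) {d k J' : ℕ} (hd : 1 ≤ d)
    (hk : 1 ≤ k)
    (hJ' : d * k ≤ J')
    (hZ : hubbardEffPartitionFnCT L M β U μ 0 K (klScale klE0 (d * k)) ≠ 0)
    {κ : ℝ} (hκ : 0 < κ)
    (hGB : IsGramBoundedR ((sectorSubMatrix L M β (bgmFatMultiplier L M klE0 β (nambuXiCT L μ K) (d * k - 1))).transpose *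
      hubbardCovSliceCT L M β μ 0 K (klScale klE0 (d * (k + 1))) (klScale klE0 (d * k)) *
        sectorSubMatrix L M β (bgmFatMultiplier L M klE0 β (nambuXiCT L μ K) (d * k - 1))) κ)
    (B : ℕ → ℝ) (hB0 : ∀ m', 0 ≤ B m') (hB00 : B 0 = 0)
    (hB : ∀ (m' : ℕ) (t : Fin (2 * m')) (w : SpaceTimeIdx L M × SectorLeg (sectorCount (d * k - 1))),
      ∑ Y ∈ univ.filter (fun Y : Fin (2 * m') → SpaceTimeIdx L M × SectorLeg (sectorCount (d * k - 1)) => Y t = w),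
        klScaleWtPow L M β jr Dw ((univ.image Y).image (latticeLegPos (2 * (2 * M)))) *
          ‖kernel ℂ (ExteriorAlgebra.map (Matrix.toLin' (sectorAnalysisMatrix L M β (klAnisoFamily L M β μ K klE0 (d * k - 1))))
            (klTowerInput L M β U μ K d k)) (2 * m') Y‖ ≤ B m')
    {α : ℝ} (hα : 0 < α)
    (hrow : ∀ X, ∑ Y, ‖((sectorSubMatrix L M β (bgmFatMultiplier L M klE0 β (nambuXiCT L μ K) (d * k - 1))).transpose *
        hubbardCovSliceCT L M β μ 0 K (klScale klE0 (d * (k + 1))) (klScale klE0 (d * k)) *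
          sectorSubMatrix L M β (bgmFatMultiplier L M klE0 β (nambuXiCT L μ K) (d * k - 1))) X Y‖ *
        klScaleWtPow L M β jr Dw {latticeLegPos (2 * (2 * M)) X, latticeLegPos (2 * (2 * M)) Y} ≤ α)
    (hcol : ∀ Y, ∑ X, ‖((sectorSubMatrix L M β (bgmFatMultiplier L M klE0 β (nambuXiCT L μ K) (d * k - 1))).transpose *
        hubbardCovSliceCT L M β μ 0 K (klScale klE0 (d * (k + 1))) (klScale klE0 (d * k)) *
          sectorSubMatrix L M β (bgmFatMultiplier L M klE0 β (nambuXiCT L μ K) (d * k - 1))) X Y‖ *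
        klScaleWtPow L M β jr Dw {latticeLegPos (2 * (2 * M)) X, latticeLegPos (2 * (2 * M)) Y} ≤ α)
    {ρ : ℝ} (hρ : 0 < ρ) {D : ℕ} (hD : Fintype.card (SpaceTimeIdx L M × SectorLeg (sectorCount (d * k - 1))) / 2 ≤ D)
    (hguard : Real.exp 1 * α / κ ^ 2 *
      towerV D ((Real.exp 2 * (κ + ρ)) ^ 2) (fun m' => imagTimeWeight β M ^ (2 * m') * B m') < 1)
    {cr cc : ℝ} (hcr0 : 0 ≤ cr) (hcc0 : 0 ≤ cc)
    (hrow' : ∀ X'', ∑ X', ‖(sectorAnalysisMatrix L M β (klAnisoFamily L M β μ K klE0 J') *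
        sectorSubMatrix L M β (bgmFatMultiplier L M klE0 β (nambuXiCT L μ K) (d * k - 1))) X'' X'‖ *
        klScaleWtPow L M β jr Dw {latticeLegPos (2 * (2 * M)) X'', latticeLegPos (2 * (2 * M)) X'} ≤ cr)
    (hcol' : ∀ X', ∑ X'', ‖(sectorAnalysisMatrix L M β (klAnisoFamily L M β μ K klE0 J') *
        sectorSubMatrix L M β (bgmFatMultiplier L M klE0 β (nambuXiCT L μ K) (d * k - 1))) X'' X'‖ *
        klScaleWtPow L M β jr Dw {latticeLegPos (2 * (2 * M)) X'', latticeLegPos (2 * (2 * M)) X'} ≤ cc)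
    {N₀ : ℕ} (hN₀ : 2 ≤ N₀) (q : ℕ) (i : Fin (2 * (q + 1))) (w'' : SpaceTimeIdx L M × SectorLeg (sectorCount J')) :
    klWtPinnedSumPow L M β μ K J' jr Dw (2 * (q + 1))
        (klTowerIncr L M β U μ K d k - grassmannLaplacian ℂ (hubbardCovSliceCT L M β μ 0 K (klScale klE0 (d * (k + 1))) (klScale klE0 (d * k))) (klTowerInput L M β U μ K d k)) i w'' ≤
      imagTimeWeight β M ^ (2 * q + 1) *
        (cr * cc ^ (2 * q + 1) *
          (towerFO D (κ ^ 2) (fun m' => if q + 2 < m' then imagTimeWeight β M ^ (2 * m') * B m' else 0) (q + 1) +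
            ∑ n ∈ Icc 2 (N₀ - 1), Real.exp 1 * (Real.exp 1 * α / κ ^ 2) ^ (n - 1) * (ρ⁻¹ ^ 2) ^ (q + 1) *
              towerS D ((Real.exp 2 * (κ + ρ)) ^ 2) (fun m' => imagTimeWeight β M ^ (2 * m') * B m') n (q + 1) +
            (ρ⁻¹ ^ 2) ^ (q + 1) * Real.exp 1 * towerV D ((Real.exp 2 * (κ + ρ)) ^ 2) (fun m' => imagTimeWeight β M ^ (2 * m') * B m') *
              (Real.exp 1 * α / κ ^ 2 * towerV D ((Real.exp 2 * (κ + ρ)) ^ 2) (fun m' => imagTimeWeight β M ^ (2 * m') * B m')) ^ (N₀ - 1) /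
              (1 - Real.exp 1 * α / κ ^ 2 * towerV D ((Real.exp 2 * (κ + ρ)) ^ 2) (fun m' => imagTimeWeight β M ^ (2 * m') * B m')))) := by
  set N : ℕ → ℝ := fun m' => imagTimeWeight β M ^ (2 * m') * B m' with hN
  have hε : 0 ≤ imagTimeWeight β M := imagTimeWeight_nonneg hβ.le M
  have hN0 : ∀ m, 0 ≤ N m := fun m => mul_nonneg (pow_nonneg hε _) (hB0 m)
  have hN00 : N 0 = 0 := by simp [hN, hB00]
  -- the door guard from the kit guard
  have hnV := normV_le_towerV (Γ := SpaceTimeIdx L M × SectorLeg (sectorCount (d * k - 1))) hκ.le hρ.le hN0 hN00 hD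
  have hθ : Real.exp 1 * α * normV (SpaceTimeIdx L M × SectorLeg (sectorCount (d * k - 1))) κ ρ N / κ ^ 2 < 1 := by
    have heq : Real.exp 1 * α * normV (SpaceTimeIdx L M × SectorLeg (sectorCount (d * k - 1))) κ ρ N / κ ^ 2 =
        Real.exp 1 * α / κ ^ 2 * normV (SpaceTimeIdx L M × SectorLeg (sectorCount (d * k - 1))) κ ρ N := by ring
    rw [heq]
    exact lt_of_le_of_lt (mul_le_mul_of_nonneg_left hnV (by positivity)) hguard
  have hborn := klWtPinnedSumPow_klTowerIncr_subTadpole_le (L := L) (M := M) hβ U μ K jr Dw hd hk hJ' hZ hκ hGB B hB0 hB hα hrow hcol hρ hθ hcc0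
    hrow' hcol' hN₀ q i w''
  have hkit := towerNumerics_doorBracketsSub_le_kit hκ hρ hα.le hcr0 hcc0 hN0 hN00 hD hN₀ q hguard
  exact hborn.trans (mul_le_mul_of_nonneg_left hkit (pow_nonneg hε _))

end Born

/-! ## §3 The sharp kit form on the tadpole-free carrier -/

section Carrier

variable [NeZero M]

/-- The truncated absolute kit sizes of the carrier majorant: `(if q+2 < m′ then ε^{2m′}·(Meas(2m′)/ε^{2m′−1}) else 0) = (if q+2 < m′ then ε·Meas(2m′) else 0)`. -/
theorem towerInputSizesPow_trunc_eq {β : ℝ} (hβ : 0 < β) (U μ : ℝ) (K : TrigPolyC4v) (d k j Dw q : ℕ) :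
    (fun m' : ℕ => if q + 2 < m' then
        imagTimeWeight β M ^ (2 * m') * (klTowerMeasWtPowAt L M β U μ K d k j Dw (2 * m') / imagTimeWeight β M ^ (2 * m' - 1)) else 0) =
      fun m' : ℕ => if q + 2 < m' then imagTimeWeight β M * klTowerMeasWtPowAt L M β U μ K d k j Dw (2 * m') else 0 := by
  have h := towerInputSizesPow_eq (L := L) (M := M) hβ U μ K d k j Dw
  funext m'
  split_ifs
  · exact congrFun h m'
  · rfl

/-- **THE DEGREE-`Dw` MODEL Hstep IN SHARP KIT FORM ON THE TADPOLE-FREE CARRIER.**  Binders as `klTowerBornWtPowAt_le_kit` (✓ …TowerBlockIncrWtPowAtKitCarrier), kit guard on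
the sizes `N m′ := ε·klTowerMeasWtPowAt … d k j Dw (2m′)`; conclusion for `klTowerBornWtPowSubTadAt … d k j Dw (2(q+1))` with the first order
`towerFO D κ² (fun m′ ↦ if q+2 < m′ then N m′ else 0) (q+1)` — for `q = 0` (two legs) the first input degree read at first order is SIX.
[cite: BenfattoGiulianiMastropietro2006, (2.70)-(2.71a), (2.77), (2.81)-(2.84), (2.86)-(2.90), (3.2)-(3.8)] -/
theorem klTowerBornWtPowSubTadAt_le_kit_sharp {β : ℝ} (hβ : 0 < β) (U μ : ℝ) (K : TrigPolyC4v) {d k : ℕ} (j Dw : ℕ) (hd : 1 ≤ d) (hk : 1 ≤ k)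
    (hZ : hubbardEffPartitionFnCT L M β U μ 0 K (klScale klE0 (d * k)) ≠ 0)
    {κ : ℝ} (hκ : 0 < κ)
    (hGB : IsGramBoundedR ((sectorSubMatrix L M β (bgmFatMultiplier L M klE0 β (nambuXiCT L μ K) (d * k - 1))).transpose *
      hubbardCovSliceCT L M β μ 0 K (klScale klE0 (d * (k + 1))) (klScale klE0 (d * k)) *
        sectorSubMatrix L M β (bgmFatMultiplier L M klE0 β (nambuXiCT L μ K) (d * k - 1))) κ)
    {α : ℝ} (hα : 0 < α)
    (hrow : ∀ X, ∑ Y, ‖((sectorSubMatrix L M β (bgmFatMultiplier L M klE0 β (nambuXiCT L μ K) (d * k - 1))).transpose *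
        hubbardCovSliceCT L M β μ 0 K (klScale klE0 (d * (k + 1))) (klScale klE0 (d * k)) *
          sectorSubMatrix L M β (bgmFatMultiplier L M klE0 β (nambuXiCT L μ K) (d * k - 1))) X Y‖ *
        klScaleWtPow L M β j Dw {latticeLegPos (2 * (2 * M)) X, latticeLegPos (2 * (2 * M)) Y} ≤ α)
    (hcol : ∀ Y, ∑ X, ‖((sectorSubMatrix L M β (bgmFatMultiplier L M klE0 β (nambuXiCT L μ K) (d * k - 1))).transpose *
        hubbardCovSliceCT L M β μ 0 K (klScale klE0 (d * (k + 1))) (klScale klE0 (d * k)) *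
          sectorSubMatrix L M β (bgmFatMultiplier L M klE0 β (nambuXiCT L μ K) (d * k - 1))) X Y‖ *
        klScaleWtPow L M β j Dw {latticeLegPos (2 * (2 * M)) X, latticeLegPos (2 * (2 * M)) Y} ≤ α)
    {ρ : ℝ} (hρ : 0 < ρ) {D : ℕ} (hD : Fintype.card (SpaceTimeIdx L M × SectorLeg (sectorCount (d * k - 1))) / 2 ≤ D)
    (hguard : Real.exp 1 * α / κ ^ 2 *
      towerV D ((Real.exp 2 * (κ + ρ)) ^ 2) (fun m' => imagTimeWeight β M * klTowerMeasWtPowAt L M β U μ K d k j Dw (2 * m')) < 1)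
    {cr cc : ℝ} (hcr0 : 0 ≤ cr) (hcc0 : 0 ≤ cc)
    (hrow' : ∀ X'', ∑ X', ‖(sectorAnalysisMatrix L M β (klAnisoFamily L M β μ K klE0 (d * k)) *
        sectorSubMatrix L M β (bgmFatMultiplier L M klE0 β (nambuXiCT L μ K) (d * k - 1))) X'' X'‖ *
        klScaleWtPow L M β j Dw {latticeLegPos (2 * (2 * M)) X'', latticeLegPos (2 * (2 * M)) X'} ≤ cr)
    (hcol' : ∀ X', ∑ X'', ‖(sectorAnalysisMatrix L M β (klAnisoFamily L M β μ K klE0 (d * k)) *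
        sectorSubMatrix L M β (bgmFatMultiplier L M klE0 β (nambuXiCT L μ K) (d * k - 1))) X'' X'‖ *
        klScaleWtPow L M β j Dw {latticeLegPos (2 * (2 * M)) X'', latticeLegPos (2 * (2 * M)) X'} ≤ cc)
    {N₀ : ℕ} (hN₀ : 2 ≤ N₀) (q : ℕ) :
    klTowerBornWtPowSubTadAt L M β U μ K d k j Dw (2 * (q + 1)) ≤
      imagTimeWeight β M ^ (2 * q + 1) *
        (cr * cc ^ (2 * q + 1) *
          (towerFO D (κ ^ 2) (fun m' => if q + 2 < m' then imagTimeWeight β M * klTowerMeasWtPowAt L M β U μ K d k j Dw (2 * m') else 0) (q + 1) +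
            ∑ n ∈ Icc 2 (N₀ - 1), Real.exp 1 * (Real.exp 1 * α / κ ^ 2) ^ (n - 1) * (ρ⁻¹ ^ 2) ^ (q + 1) *
              towerS D ((Real.exp 2 * (κ + ρ)) ^ 2) (fun m' => imagTimeWeight β M * klTowerMeasWtPowAt L M β U μ K d k j Dw (2 * m')) n (q + 1) +
            (ρ⁻¹ ^ 2) ^ (q + 1) * Real.exp 1 *
              towerV D ((Real.exp 2 * (κ + ρ)) ^ 2) (fun m' => imagTimeWeight β M * klTowerMeasWtPowAt L M β U μ K d k j Dw (2 * m')) *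
              (Real.exp 1 * α / κ ^ 2 *
                towerV D ((Real.exp 2 * (κ + ρ)) ^ 2) (fun m' => imagTimeWeight β M * klTowerMeasWtPowAt L M β U μ K d k j Dw (2 * m'))) ^ (N₀ - 1) /
              (1 - Real.exp 1 * α / κ ^ 2 *
                towerV D ((Real.exp 2 * (κ + ρ)) ^ 2) (fun m' => imagTimeWeight β M * klTowerMeasWtPowAt L M β U μ K d k j Dw (2 * m'))))) := by
  have hε := imagTimeWeight_pos_of_pos (M := M) hβ
  set B : ℕ → ℝ := fun m' => klTowerMeasWtPowAt L M β U μ K d k j Dw (2 * m') / imagTimeWeight β M ^ (2 * m' - 1) with hBdef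
  have hB0 : ∀ m', 0 ≤ B m' := fun m' => div_nonneg (klTowerMeasWtPowAt_nonneg hβ.le U μ K d k j Dw _) (pow_nonneg hε.le _)
  have hB00 : B 0 = 0 := by simp [hBdef, klTowerMeasWtPowAt_zero]
  have hB : ∀ (m' : ℕ) (t : Fin (2 * m')) (w : SpaceTimeIdx L M × SectorLeg (sectorCount (d * k - 1))),
      ∑ Y ∈ univ.filter (fun Y : Fin (2 * m') → SpaceTimeIdx L M × SectorLeg (sectorCount (d * k - 1)) => Y t = w),
        klScaleWtPow L M β j Dw ((univ.image Y).image (latticeLegPos (2 * (2 * M)))) *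
          ‖kernel ℂ (ExteriorAlgebra.map (Matrix.toLin' (sectorAnalysisMatrix L M β (klAnisoFamily L M β μ K klE0 (d * k - 1))))
            (klTowerInput L M β U μ K d k)) (2 * m') Y‖ ≤ B m' :=
    fun m' t w => towerInputMajorant_of_klTowerMeasWtPowAt hβ U μ K d k j Dw m' t w
  have hNeq := towerInputSizesPow_eq (L := L) (M := M) hβ U μ K d k j Dw
  have hNeq' := towerInputSizesPow_trunc_eq (L := L) (M := M) hβ U μ K d k j Dw q
  -- the kit guard in `B`-form
  have hguard' : Real.exp 1 * α / κ ^ 2 *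
      towerV D ((Real.exp 2 * (κ + ρ)) ^ 2) (fun m' => imagTimeWeight β M ^ (2 * m') * B m') < 1 := by
    rw [hBdef]; rw [hNeq]; exact hguard
  -- pin by pin, then the supremum
  unfold klTowerBornWtPowSubTadAt
  rcases isEmpty_or_nonempty (Fin (2 * (q + 1)) × (SpaceTimeIdx L M × SectorLeg (sectorCount (d * k)))) with h | h
  · rw [Real.iSup_of_isEmpty]
    have hM0 : ∀ m', 0 ≤ imagTimeWeight β M * klTowerMeasWtPowAt L M β U μ K d k j Dw (2 * m') :=
      fun m' => mul_nonneg hε.le (klTowerMeasWtPowAt_nonneg hβ.le U μ K d k j Dw _)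
    have hV0 : 0 ≤ towerV D ((Real.exp 2 * (κ + ρ)) ^ 2) (fun m' => imagTimeWeight β M * klTowerMeasWtPowAt L M β U μ K d k j Dw (2 * m')) :=
      towerV_nonneg (by positivity) hM0
    have hFO0 : 0 ≤ towerFO D (κ ^ 2)
        (fun m' => if q + 2 < m' then imagTimeWeight β M * klTowerMeasWtPowAt L M β U μ K d k j Dw (2 * m') else 0) (q + 1) :=
      towerFO_nonneg (sq_nonneg κ) (fun m' => by split_ifs; exacts [hM0 m', le_rfl]) _
    have hS0 : ∀ n, 0 ≤ towerS D ((Real.exp 2 * (κ + ρ)) ^ 2)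
        (fun m' => imagTimeWeight β M * klTowerMeasWtPowAt L M β U μ K d k j Dw (2 * m')) n (q + 1) := fun n =>
      towerS_nonneg (by positivity) hM0 _ _
    have h1 : 0 ≤ 1 - Real.exp 1 * α / κ ^ 2 *
        towerV D ((Real.exp 2 * (κ + ρ)) ^ 2) (fun m' => imagTimeWeight β M * klTowerMeasWtPowAt L M β U μ K d k j Dw (2 * m')) :=
      sub_nonneg.2 hguard.le
    have hsum : 0 ≤ ∑ n ∈ Icc 2 (N₀ - 1), Real.exp 1 * (Real.exp 1 * α / κ ^ 2) ^ (n - 1) * (ρ⁻¹ ^ 2) ^ (q + 1) *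
        towerS D ((Real.exp 2 * (κ + ρ)) ^ 2) (fun m' => imagTimeWeight β M * klTowerMeasWtPowAt L M β U μ K d k j Dw (2 * m')) n (q + 1) :=
      sum_nonneg fun n _ => by have := hS0 n; positivity
    positivity
  · refine ciSup_le fun iw => ?_
    have h := klWtPinnedSumPow_klTowerIncr_subTadpole_le_kit_sharp (L := L) (M := M) hβ U μ K j Dw hd hk le_rfl hZ hκ hGB B hB0 hB00 hB hα hrow hcol
      hρ hD hguard' hcr0 hcc0 hrow' hcol' hN₀ q iw.1 iw.2
    rw [hBdef] at h; rw [hNeq, hNeq'] at h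
    exact h

/-! ## §4 The sharp kit form on the tadpole-free carrier, divided by units -/

/-- **THE TADPOLE-FREE DEGREE-`Dw` Hstep IN THE KIT'S DIMENSIONLESS FORM, ANY UNITS `(u, Kc)`** (twin of `klTowerBornWtPowAt_le_kit_units`): with
`μ m := klTowerMeasWtPowAt … d k j Dw (2m)/(Kc·u^m)` and the truncated `μ♭ m := if q+2 < m then μ m else 0`,
`klTowerBornWtPowSubTadAt … d k j Dw (2(q+1)) ≤ (ε·cr)·(ε·cc)^{2q+1}·(u^{q+1}·Kc)·[towerFO D (κ²u) μ♭ (q+1) + Σ e·Φ̂^{n−1}·ψ̂^{q+1}·towerS D (τu) μ n (q+1) + ψ̂^{q+1}·e·V̂·(Φ̂V̂)^{N₀−1}/(1−Φ̂V̂)]`,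
`τ = (e²(κ+ρ))²`, `Φ̂ = (eα/κ²)·(ε·Kc)`, `ψ̂ = ρ⁻²/u`, `V̂ = towerV D (τu) μ`. [cite: BenfattoGiulianiMastropietro2006, (2.70)-(2.71a), §2.8 (2.83), §3 (3.2)-(3.8)] -/
theorem klTowerBornWtPowSubTadAt_le_kit_units {β : ℝ} (hβ : 0 < β) (U μ : ℝ) (K : TrigPolyC4v) {d k : ℕ} (j Dw : ℕ) (hd : 1 ≤ d) (hk : 1 ≤ k)
    (hZ : hubbardEffPartitionFnCT L M β U μ 0 K (klScale klE0 (d * k)) ≠ 0)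
    {κ : ℝ} (hκ : 0 < κ)
    (hGB : IsGramBoundedR ((sectorSubMatrix L M β (bgmFatMultiplier L M klE0 β (nambuXiCT L μ K) (d * k - 1))).transpose *
      hubbardCovSliceCT L M β μ 0 K (klScale klE0 (d * (k + 1))) (klScale klE0 (d * k)) *
        sectorSubMatrix L M β (bgmFatMultiplier L M klE0 β (nambuXiCT L μ K) (d * k - 1))) κ)
    {α : ℝ} (hα : 0 < α)
    (hrow : ∀ X, ∑ Y, ‖((sectorSubMatrix L M β (bgmFatMultiplier L M klE0 β (nambuXiCT L μ K) (d * k - 1))).transpose *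
        hubbardCovSliceCT L M β μ 0 K (klScale klE0 (d * (k + 1))) (klScale klE0 (d * k)) *
          sectorSubMatrix L M β (bgmFatMultiplier L M klE0 β (nambuXiCT L μ K) (d * k - 1))) X Y‖ *
        klScaleWtPow L M β j Dw {latticeLegPos (2 * (2 * M)) X, latticeLegPos (2 * (2 * M)) Y} ≤ α)
    (hcol : ∀ Y, ∑ X, ‖((sectorSubMatrix L M β (bgmFatMultiplier L M klE0 β (nambuXiCT L μ K) (d * k - 1))).transpose *
        hubbardCovSliceCT L M β μ 0 K (klScale klE0 (d * (k + 1))) (klScale klE0 (d * k)) *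
          sectorSubMatrix L M β (bgmFatMultiplier L M klE0 β (nambuXiCT L μ K) (d * k - 1))) X Y‖ *
        klScaleWtPow L M β j Dw {latticeLegPos (2 * (2 * M)) X, latticeLegPos (2 * (2 * M)) Y} ≤ α)
    {ρ : ℝ} (hρ : 0 < ρ) {D : ℕ} (hD : Fintype.card (SpaceTimeIdx L M × SectorLeg (sectorCount (d * k - 1))) / 2 ≤ D)
    (hguard : Real.exp 1 * α / κ ^ 2 *
      towerV D ((Real.exp 2 * (κ + ρ)) ^ 2) (fun m' => imagTimeWeight β M * klTowerMeasWtPowAt L M β U μ K d k j Dw (2 * m')) < 1)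
    {cr cc : ℝ} (hcr0 : 0 ≤ cr) (hcc0 : 0 ≤ cc)
    (hrow' : ∀ X'', ∑ X', ‖(sectorAnalysisMatrix L M β (klAnisoFamily L M β μ K klE0 (d * k)) *
        sectorSubMatrix L M β (bgmFatMultiplier L M klE0 β (nambuXiCT L μ K) (d * k - 1))) X'' X'‖ *
        klScaleWtPow L M β j Dw {latticeLegPos (2 * (2 * M)) X'', latticeLegPos (2 * (2 * M)) X'} ≤ cr)
    (hcol' : ∀ X', ∑ X'', ‖(sectorAnalysisMatrix L M β (klAnisoFamily L M β μ K klE0 (d * k)) *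
        sectorSubMatrix L M β (bgmFatMultiplier L M klE0 β (nambuXiCT L μ K) (d * k - 1))) X'' X'‖ *
        klScaleWtPow L M β j Dw {latticeLegPos (2 * (2 * M)) X'', latticeLegPos (2 * (2 * M)) X'} ≤ cc)
    {N₀ : ℕ} (hN₀ : 2 ≤ N₀) (q : ℕ) {u Kc : ℝ} (hu : 0 < u) (hKc : 0 < Kc) :
    klTowerBornWtPowSubTadAt L M β U μ K d k j Dw (2 * (q + 1)) ≤
      (imagTimeWeight β M * cr) * (imagTimeWeight β M * cc) ^ (2 * q + 1) * (u ^ (q + 1) * Kc) *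
        (towerFO D (κ ^ 2 * u) (fun m => if q + 2 < m then klTowerMeasWtPowAt L M β U μ K d k j Dw (2 * m) / (Kc * u ^ m) else 0) (q + 1) +
          ∑ n ∈ Icc 2 (N₀ - 1), Real.exp 1 * (Real.exp 1 * α / κ ^ 2 * (imagTimeWeight β M * Kc)) ^ (n - 1) * (ρ⁻¹ ^ 2 / u) ^ (q + 1) *
            towerS D ((Real.exp 2 * (κ + ρ)) ^ 2 * u) (fun m => klTowerMeasWtPowAt L M β U μ K d k j Dw (2 * m) / (Kc * u ^ m)) n (q + 1) +
          (ρ⁻¹ ^ 2 / u) ^ (q + 1) * Real.exp 1 *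
            towerV D ((Real.exp 2 * (κ + ρ)) ^ 2 * u) (fun m => klTowerMeasWtPowAt L M β U μ K d k j Dw (2 * m) / (Kc * u ^ m)) *
            (Real.exp 1 * α / κ ^ 2 * (imagTimeWeight β M * Kc) *
              towerV D ((Real.exp 2 * (κ + ρ)) ^ 2 * u) (fun m => klTowerMeasWtPowAt L M β U μ K d k j Dw (2 * m) / (Kc * u ^ m))) ^ (N₀ - 1) /
            (1 - Real.exp 1 * α / κ ^ 2 * (imagTimeWeight β M * Kc) *
              towerV D ((Real.exp 2 * (κ + ρ)) ^ 2 * u) (fun m => klTowerMeasWtPowAt L M β U μ K d k j Dw (2 * m) / (Kc * u ^ m)))) := by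
  have hε := imagTimeWeight_pos_of_pos (M := M) hβ
  have h := klTowerBornWtPowSubTadAt_le_kit_sharp (L := L) (M := M) hβ U μ K j Dw hd hk hZ hκ hGB hα hrow hcol hρ hD hguard hcr0 hcc0 hrow' hcol' hN₀ q
  have hN := towerInputSizes_units (ε := imagTimeWeight β M) hu.ne' hKc.ne' (fun m => klTowerMeasWtPowAt L M β U μ K d k j Dw m)
  have hN' := towerInputSizes_units_trunc (ε := imagTimeWeight β M) hu.ne' hKc.ne' (fun m => klTowerMeasWtPowAt L M β U μ K d k j Dw m) q
  rw [hN, hN'] at h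
  rw [kitStep_abs_eq_units_mul_trunc (mul_ne_zero hε.ne' hKc.ne') hu.ne'] at h
  refine h.trans (le_of_eq ?_)
  ring

end Carrier

end Summit.HubbardSuperconductivity.HubbardSuperconductivity.Theorems.EngineV8

end
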